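import Summits.QuantumAdvantage.AdviceFreeQNC0.WindowLocalHard
import Summits.QuantumAdvantage.AdviceFreeQNC0.RingHardOdd
import Summits.QuantumAdvantage.AdviceFreeQNC0.WalkTubeRank
import HarnessLib

/-!
# Cell qa-qnc0 (p = 3 line, crux `RingDenseResidualLt3`): LOCAL ring strategies of POLYLOG RADIUS lose —
# R-loc at polylog radius is a corollary of the cross-free window theorem

Planner qa-qnc0-p1 g19's ask P-18g wants `θ < 1` for the class of radius-`w` LOCAL ring strategies
(output bit `k` depends only on the pattern bits at cyclic distance `≤ w` from `k`; ARBITRARY dependence, no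
degree hypothesis) — "crux 22907 needs only some θ < 1".  For POLYLOG radius this needs no block game:

* `ringLocal_polylog_lt3` — there is ONE `θ < 1` such that for every `C`, all large `N`, every
  `w ≤ (log₂ N)^C` and every radius-`w` local `f`, `#{x odd : Rel x (f x)} ≤ θ·2^{N-1}`.

Proof: transport to walk coordinates (`WalkTransport.rel_iff_ringWinU`, `xOfU_uVec`: the odd class injects
by `uVec`, and `x_j = xOfU u j` reads only `u_{j-1}, u_j`), so the transported selector `y_g` is a junta on the
`≤ 4w + 8` walk bits near `g` (cyclically) — hence of `𝔽₂`-degree `≤ 4w + 8` (junta-degree lemma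
`ind_mem_lowDeg_of_dependsOn`) — and a window `[p, p+L) ++ gap ++ [·, ·+M)` placed in the MIDDLE of the cycle
(gap `≥ 2w + 4`, away from the wrap point) is cross-free; the tree's CROSS-FREE WINDOW THEOREM
`ringWinU_crossFree_le` (qn-prover-3 g3, PLDAMS over `𝔽₂`) finishes.  Field-free: the adversary's algebra never
enters.  Compare `windowLocalHardU` (walk frame, linear windows): here the locality is CYCLIC in the ring frame,
and the wrap-around bells are handled by placing the window in the middle.

WHAT THIS IS NOT: not the planner's `RingLocalLt3` (sharp `8/9 + ε`, LINEAR radius `c(w+1) ≤ N`, via the block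
game) — the radius here is polylogarithmic and `θ` is the unoptimised constant of the window theorem; nothing on
non-local strategies; crux 22907 untouched; separation NOT moved.
-/

noncomputable section

namespace Summit.QuantumAdvantage.AdviceFreeQNC0

open Finset Literature.Computability.QuantumComplexity Literature.Computability.MetaComplexity
open Literature.Computability.MetaComplexity.Smolensky

namespace RingLocalPolylog

variable {n : ℕ}

/-! ### The transported selector and its reads -/

/-- `xOfU u j` reads only `u_j` and `u_{j-1}`. -/
theorem xOfU_congr (u v : Fin n → Bool) (j : Fin (n + 1))
    (h : ∀ i : Fin n, (i.val = j.val ∨ i.val + 1 = j.val) → u i = v i) : xOfU u j = xOfU v j := by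
  have key : ∀ m : ℕ, (m = j.val ∨ m + 1 = j.val) → uExt u m = uExt v m := by
    intro m hm
    unfold uExt
    split_ifs with hlt
    · exact h ⟨m, hlt⟩ hm
    · rfl
  unfold xOfU
  rw [key j.val (Or.inl rfl)]
  by_cases hj : j.val = 0
  · rw [if_pos hj, if_pos hj]
  · rw [if_neg hj, if_neg hj, key (j.val - 1) (Or.inr (by omega))]

/-- Cyclic proximity of a position `j` to the cut `g` at radius `w` (the locality relation of
`RingLocalLt3`), or `j ∈ {g, g+1}` (read by the canonical guess). -/
def Near (w : ℕ) (g j : Fin (n + 1)) : Prop :=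
  ((j.val + (n + 1) - g.val) % (n + 1) ≤ w ∨ (g.val + (n + 1) - j.val) % (n + 1) ≤ w) ∨ j = g ∨ j = RingHLF.nxt g

/-- `Near` is decidable. -/
instance (w : ℕ) (g j : Fin (n + 1)) : Decidable (Near w g j) := by unfold Near; infer_instance

/-- The walk bits read by the transported selector at cut `g`: `u_i` with `i = j` or `i = j - 1` for some
near position `j`. -/
def reads (w : ℕ) (g : Fin (n + 1)) : Finset (Fin n) :=
  univ.filter fun i : Fin n => ∃ j : Fin (n + 1), Near w g j ∧ (i.val = j.val ∨ i.val + 1 = j.val)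

/-- The rotation `j ↦ (j - g) mod N` in closed form. -/
theorem rot_eq (g j : Fin (n + 1)) :
    (j.val + (n + 1) - g.val) % (n + 1) = if g.val ≤ j.val then j.val - g.val else j.val + (n + 1) - g.val := by
  have hj := j.isLt
  have hg := g.isLt
  split_ifs with h
  · rw [show j.val + (n + 1) - g.val = (j.val - g.val) + (n + 1) from by omega, Nat.add_mod_right,
      Nat.mod_eq_of_lt (by omega)]
  · exact Nat.mod_eq_of_lt (by omega)

/-- The near positions number at most `2(w+1) + 2`. -/
theorem card_near_le (w : ℕ) (g : Fin (n + 1)) :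
    (univ.filter fun j : Fin (n + 1) => Near w g j).card ≤ 2 * (w + 1) + 2 := by
  have hA : (univ.filter fun j : Fin (n + 1) => (j.val + (n + 1) - g.val) % (n + 1) ≤ w).card ≤ w + 1 := by
    calc _ ≤ (range (w + 1)).card := by
          refine card_le_card_of_injOn (fun j => (j.val + (n + 1) - g.val) % (n + 1)) ?_ ?_
          · intro j hj
            simp only [mem_coe, mem_filter, mem_univ, true_and, mem_range] at hj ⊢
            omega
          · intro j hj j' hj' h
            have r1 := rot_eq g j
            have r2 := rot_eq g j'
            simp only at h
            rw [r1, r2] at h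
            have := j.isLt; have := j'.isLt; have := g.isLt
            apply Fin.ext
            split_ifs at h <;> omega
      _ = w + 1 := card_range _
  have hB : (univ.filter fun j : Fin (n + 1) => (g.val + (n + 1) - j.val) % (n + 1) ≤ w).card ≤ w + 1 := by
    calc _ ≤ (range (w + 1)).card := by
          refine card_le_card_of_injOn (fun j : Fin (n + 1) => (g.val + (n + 1) - j.val) % (n + 1)) ?_ ?_
          · intro j hj
            simp only [mem_coe, mem_filter, mem_univ, true_and, mem_range] at hj ⊢
            omega
          · intro j hj j' hj' h
            have r1 := rot_eq j g
            have r2 := rot_eq j' g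
            simp only at h
            rw [r1, r2] at h
            have := j.isLt; have := j'.isLt; have := g.isLt
            apply Fin.ext
            split_ifs at h <;> omega
      _ = w + 1 := card_range _
  have hC : (univ.filter fun j : Fin (n + 1) => j = g ∨ j = RingHLF.nxt g).card ≤ 2 := by
    calc _ ≤ ({g, RingHLF.nxt g} : Finset (Fin (n + 1))).card :=
          card_le_card fun j hj => by rw [mem_filter] at hj; simpa using hj.2
      _ ≤ 2 := card_le_two
  calc (univ.filter fun j : Fin (n + 1) => Near w g j).card
      ≤ ((univ.filter fun j : Fin (n + 1) => (j.val + (n + 1) - g.val) % (n + 1) ≤ w) ∪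
          ((univ.filter fun j : Fin (n + 1) => (g.val + (n + 1) - j.val) % (n + 1) ≤ w) ∪
            (univ.filter fun j : Fin (n + 1) => j = g ∨ j = RingHLF.nxt g))).card := by
        refine card_le_card fun j hj => ?_
        rw [mem_filter] at hj
        simp only [mem_union, mem_filter, mem_univ, true_and]
        unfold Near at hj
        tauto
    _ ≤ _ := by
        refine (card_union_le _ _).trans ?_
        have := card_union_le (univ.filter fun j : Fin (n + 1) => (g.val + (n + 1) - j.val) % (n + 1) ≤ w)
          (univ.filter fun j : Fin (n + 1) => j = g ∨ j = RingHLF.nxt g)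
        omega

/-- The read set has at most `4w + 8` bits. -/
theorem card_reads_le (w : ℕ) (g : Fin (n + 1)) : (reads w g).card ≤ 4 * w + 8 := by
  have hsub : reads w g ⊆ (univ.filter fun j : Fin (n + 1) => Near w g j).biUnion
      fun j => univ.filter fun i : Fin n => i.val = j.val ∨ i.val + 1 = j.val := by
    intro i hi
    unfold reads at hi
    rw [mem_filter] at hi
    obtain ⟨j, hj, hij⟩ := hi.2
    rw [mem_biUnion]
    exact ⟨j, mem_filter.2 ⟨mem_univ _, hj⟩, mem_filter.2 ⟨mem_univ _, hij⟩⟩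
  refine (card_le_card hsub).trans (card_biUnion_le.trans ?_)
  have hfib : ∀ j : Fin (n + 1), (univ.filter fun i : Fin n => i.val = j.val ∨ i.val + 1 = j.val).card ≤ 2 := by
    intro j
    calc _ ≤ ({j.val, j.val - 1} : Finset ℕ).card := by
          refine card_le_card_of_injOn Fin.val (fun i hi => ?_) (fun i _ i' _ h => Fin.ext h)
          rw [mem_coe, mem_filter] at hi
          rw [mem_coe, mem_insert, mem_singleton]; omega
      _ ≤ 2 := card_le_two
  calc ∑ j ∈ univ.filter (fun j : Fin (n + 1) => Near w g j),
        (univ.filter fun i : Fin n => i.val = j.val ∨ i.val + 1 = j.val).card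
      ≤ ∑ j ∈ univ.filter (fun j : Fin (n + 1) => Near w g j), 2 := sum_le_sum fun j _ => hfib j
    _ = 2 * (univ.filter fun j : Fin (n + 1) => Near w g j).card := by rw [sum_const, smul_eq_mul, mul_comm]
    _ ≤ 4 * w + 8 := by have := card_near_le w g; omega

/-- The transported selector of a radius-`w` local ring strategy depends only on its read set. -/
theorem transported_congr (w : ℕ) (f : (Fin (n + 1) → Bool) → (Fin (n + 1) → Bool))
    (hf : ∀ x x' : Fin (n + 1) → Bool, ∀ k : Fin (n + 1),
      (∀ j : Fin (n + 1), ((j.val + (n + 1) - k.val) % (n + 1) ≤ w ∨ (k.val + (n + 1) - j.val) % (n + 1) ≤ w) →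
        x j = x' j) → f x k = f x' k)
    (g : Fin (n + 1)) (u v : Fin n → Bool) (huv : ∀ i ∈ reads w g, u i = v i) :
    xor (f (xOfU u) g) (tGuess (xOfU u) g) = xor (f (xOfU v) g) (tGuess (xOfU v) g) := by
  have hx : ∀ j : Fin (n + 1), Near w g j → xOfU u j = xOfU v j := by
    intro j hj
    refine xOfU_congr u v j fun i hi => huv i ?_
    unfold reads
    exact mem_filter.2 ⟨mem_univ _, j, hj, hi⟩
  have h1 : f (xOfU u) g = f (xOfU v) g := hf _ _ g fun j hj => hx j (Or.inl hj)
  have h2 : tGuess (xOfU u) g = tGuess (xOfU v) g := by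
    unfold tGuess
    rw [hx g (Or.inr (Or.inl rfl)), hx (RingHLF.nxt g) (Or.inr (Or.inr rfl))]
  rw [h1, h2]

/-- Middle cuts: for `w + 1 ≤ g` and `g + w + 1 ≤ n`, every read bit lies within linear distance `w + 1` of
`g` (no wrap-around). -/
theorem reads_subset_interval (w : ℕ) (g : Fin (n + 1)) (hg1 : w + 1 ≤ g.val) (hg2 : g.val + w + 1 ≤ n)
    {i : Fin n} (hi : i ∈ reads w g) : g.val ≤ i.val + w + 1 ∧ i.val ≤ g.val + w + 1 := by
  unfold reads at hi
  rw [mem_filter] at hi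
  obtain ⟨j, hj, hij⟩ := hi.2
  have hjv := j.isLt
  have hgv := g.isLt
  -- `j` is within linear distance `w` of `g`, or `j ∈ {g, g+1}`
  have hlin : g.val ≤ j.val + w ∧ j.val ≤ g.val + w + 1 := by
    unfold Near at hj
    rcases hj with (h | h) | h | h
    · rw [rot_eq] at h; split_ifs at h <;> omega
    · rw [rot_eq] at h; split_ifs at h <;> omega
    · have e := congrArg Fin.val h; omega
    · have hv : j.val = (g.val + 1) % (n + 1) := congrArg Fin.val h
      by_cases hlt : g.val + 1 < n + 1
      · rw [Nat.mod_eq_of_lt hlt] at hv; omega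
      · rw [show g.val + 1 = n + 1 from by omega, Nat.mod_self] at hv; omega
  omega

end RingLocalPolylog

open RingLocalPolylog

/-- **R-loc at polylog radius (p = 3 line; field-free).**  There is `θ < 1` such that for every `C`, all
large `N`, every radius `w ≤ (log₂ N)^C` and every radius-`w` LOCAL ring strategy `f` (output bit `k` reads only
the pattern bits at cyclic distance `≤ w` from `k`; arbitrary dependence), `f` satisfies the ring relation on at
most `θ·2^{N-1}` odd patterns.  (Transport to walk coordinates + the cross-free window theorem
`ringWinU_crossFree_le` with the window placed in the middle of the cycle.) -/
theorem ringLocal_polylog_lt3 :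
    ∃ θ : ℝ, θ < 1 ∧ ∀ C : ℕ, ∃ N₀ : ℕ, ∀ N ≥ N₀, ∀ w : ℕ, w ≤ (Nat.log 2 N) ^ C →
      ∀ f : (Fin N → Bool) → (Fin N → Bool),
        (∀ x x' : Fin N → Bool, ∀ k : Fin N,
          (∀ j : Fin N, ((j.val + N - k.val) % N ≤ w ∨ (k.val + N - j.val) % N ≤ w) → x j = x' j) →
            f x k = f x' k) →
        haveI : DecidablePred (fun x : Fin N → Bool => OddZeros x ∧ RingHLF.Rel x (f x)) :=
          fun _ => Classical.propDecidable _
        ((univ.filter fun x : Fin N → Bool => OddZeros x ∧ RingHLF.Rel x (f x)).card : ℝ) ≤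
          θ * (2 : ℝ) ^ (N - 1) := by
  obtain ⟨θ, hθ, H⟩ := ringWinU_crossFree_le
  refine ⟨θ, hθ, fun C => ?_⟩
  -- degree exponent `K = 2C + 4` absorbs the junta size `4w + 8`
  set K := 2 * C + 4 with hK
  obtain ⟨n₁, hn₁⟩ := H K
  obtain ⟨n₂, hn₂⟩ := TubePlanProof.logPow_le_natSqrt (2 * K + 2)
  refine ⟨max (n₁ + 1) (max (n₂ + 1) 257), fun N hN w hw f hf => ?_⟩
  obtain ⟨n, rfl⟩ : ∃ n, N = n + 1 := ⟨N - 1, by have := le_max_left (n₁ + 1) (max (n₂ + 1) 257); omega⟩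
  have hn₁n : n₁ ≤ n := by have := le_max_left (n₁ + 1) (max (n₂ + 1) 257); omega
  have hn₂n : n₂ ≤ n := by
    have := le_trans (le_max_left _ _) (le_max_right (n₁ + 1) (max (n₂ + 1) 257)); omega
  have hn256 : 256 ≤ n := by
    have := le_trans (le_max_right _ _) (le_max_right (n₁ + 1) (max (n₂ + 1) 257)); omega
  have hlog8 : 8 ≤ Nat.log 2 n := Nat.le_log_of_pow_le (by norm_num) hn256
  -- `w ≤ (log₂ (n+1))^C ≤ (2 log₂ n)^C ≤ (log₂ n)^{2C}`
  have hlogN : Nat.log 2 (n + 1) ≤ 2 * Nat.log 2 n := by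
    calc Nat.log 2 (n + 1) ≤ Nat.log 2 (n * 2) := Nat.log_mono_right (by omega)
      _ = Nat.log 2 n + 1 := Nat.log_mul_base (by norm_num) (by omega)
      _ ≤ 2 * Nat.log 2 n := by omega
  have hw' : w ≤ (Nat.log 2 n) ^ (2 * C) := by
    calc w ≤ (Nat.log 2 (n + 1)) ^ C := by simpa using hw
      _ ≤ (2 * Nat.log 2 n) ^ C := Nat.pow_le_pow_left hlogN C
      _ = 2 ^ C * (Nat.log 2 n) ^ C := by rw [mul_pow]
      _ ≤ (Nat.log 2 n) ^ C * (Nat.log 2 n) ^ C :=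
          Nat.mul_le_mul_right _ (Nat.pow_le_pow_left (by omega) C)
      _ = (Nat.log 2 n) ^ (2 * C) := by rw [← pow_add, two_mul]
  -- the junta size fits the degree budget `(log₂ n)^K`
  have hjunta : 4 * w + 8 ≤ (Nat.log 2 n) ^ K := by
    have h1 : (Nat.log 2 n) ^ K = (Nat.log 2 n) ^ (2 * C) * (Nat.log 2 n) ^ 4 := by
      rw [hK, pow_add]
    have h2 : 16 ≤ (Nat.log 2 n) ^ 4 := by
      calc (16 : ℕ) = 2 ^ 4 := by norm_num
        _ ≤ (Nat.log 2 n) ^ 4 := Nat.pow_le_pow_left (by omega) 4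
    have h3 : 1 ≤ (Nat.log 2 n) ^ (2 * C) := Nat.one_le_pow _ _ (by omega)
    rw [h1]
    calc 4 * w + 8 ≤ 4 * (Nat.log 2 n) ^ (2 * C) + 8 * (Nat.log 2 n) ^ (2 * C) := by omega
      _ = (Nat.log 2 n) ^ (2 * C) * 12 := by ring
      _ ≤ (Nat.log 2 n) ^ (2 * C) * (Nat.log 2 n) ^ 4 := Nat.mul_le_mul_left _ (by omega)
  -- room for the window
  set L := (Nat.log 2 n) ^ (2 * K + 1) with hL
  have hroom : 8 * L ≤ n := by
    have h1 := hn₂ n hn₂n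
    have h2 : (Nat.log 2 n) ^ (2 * K + 2) = L * Nat.log 2 n := by rw [hL, pow_succ]
    have h3 : Nat.sqrt n ≤ n := Nat.sqrt_le_self n
    rw [h2] at h1
    calc 8 * L = L * 8 := by ring
      _ ≤ L * Nat.log 2 n := Nat.mul_le_mul_left _ hlog8
      _ ≤ Nat.sqrt n := h1
      _ ≤ n := h3
  have hwL : w ≤ L := by
    refine hw'.trans (Nat.pow_le_pow_right (by omega) (by omega))
  have hL4 : 4 ≤ L := le_trans (by norm_num) (le_trans hlog8 (by
    calc Nat.log 2 n = (Nat.log 2 n) ^ 1 := (pow_one _).symm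
      _ ≤ L := Nat.pow_le_pow_right (by omega) (by omega)))
  -- the window `[p, p+L) ++ [p+L, p+L+Hg) ++ [p+L+Hg, p+L+Hg+L)`
  set p := w + 2 with hp
  set Hg := 2 * w + 4 with hHg
  have hfit : p + (L + Hg + L) + w + 2 ≤ n := by omega
  -- the transported strategy
  set y : Fin (n + 1) → (Fin n → Bool) → Bool := fun g u => xor (f (xOfU u) g) (tGuess (xOfU u) g) with hy
  have hdep : ∀ g (u v : Fin n → Bool), (∀ i ∈ reads w g, u i = v i) → y g u = y g v :=
    fun g u v huv => transported_congr w f hf g u v huv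
  have hdeg : ∀ g, HasDeg (y g) ((Nat.log 2 n) ^ K) := by
    intro g
    unfold HasDeg
    exact lowDeg_mono ((card_reads_le w g).trans hjunta) (ind_mem_lowDeg_of_dependsOn (reads w g) (y g) (hdep g))
  have hcross1 : ∀ g : Fin (n + 1), p < g.val → g.val < p + L → ∀ u u' : Fin n → Bool,
      (∀ i : Fin n, ¬ (p + (L + Hg) ≤ i.val ∧ i.val < p + (L + Hg + L)) → u i = u' i) → y g u = y g u' := by
    intro g hg1 hg2 u u' huu'
    refine hdep g u u' fun i hi => huu' i ?_
    have := reads_subset_interval w g (by omega) (by omega) hi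
    omega
  have hcross3 : ∀ g : Fin (n + 1), p + (L + Hg) < g.val → g.val < p + (L + Hg + L) → ∀ u u' : Fin n → Bool,
      (∀ i : Fin n, ¬ (p ≤ i.val ∧ i.val < p + L) → u i = u' i) → y g u = y g u' := by
    intro g hg1 hg2 u u' huu'
    refine hdep g u u' fun i hi => huu' i ?_
    have := reads_subset_interval w g (by omega) (by omega) hi
    omega
  have hwin := hn₁ n hn₁n p L Hg L (by omega) le_rfl le_rfl (n + 2) y hdeg hcross1 hcross3
  -- the odd class injects by `uVec` (stated for any set of odd winners, to stay instance-free)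
  have hinj : ∀ S : Finset (Fin (n + 1) → Bool), (∀ x ∈ S, OddZeros x ∧ RingHLF.Rel x (f x)) →
      S.card ≤ (univ.filter fun u : Fin n → Bool => ringWinU (n + 2) y u = true).card := by
    intro S hS
    refine card_le_card_of_injOn uVec (fun x hx => ?_) (fun x₁ hx₁ x₂ hx₂ h => ?_)
    · have hx' := hS x (mem_coe.1 hx)
      rw [mem_coe, mem_filter]
      exact ⟨mem_univ _, (rel_iff_ringWinU (by omega) x hx'.1 f).1 hx'.2⟩
    · have h₁ := hS x₁ (mem_coe.1 hx₁)
      have h₂ := hS x₂ (mem_coe.1 hx₂)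
      rw [← xOfU_uVec (by omega) x₁ h₁.1, ← xOfU_uVec (by omega) x₂ h₂.1, h]
  rw [Nat.add_sub_cancel]
  refine le_trans ?_ hwin
  refine (Nat.cast_le (α := ℝ)).2 (hinj _ fun x hx => ?_)
  simp only [mem_filter, mem_univ, true_and] at hx
  exact hx

end Summit.QuantumAdvantage.AdviceFreeQNC0

end
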